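import Literature.NumberTheory.DiophantineGeometry.PastenSubexpPlaces
import HarnessLib

/-!
# Pasten's subexponential abc bounds, V: Theorem 1.4 from Theorems 2.1 and 2.5

Topic `NumberTheory/DiophantineGeometry`; namespace `Literature.NumberTheory.DiophantineGeometry.Pasten`.

Pasten, Invent. Math. 236 (2024), §4 (proof of Theorem 1.4 (1)) and §5 (proof of
Theorem 1.4 (2)) [cite: Pasten2024, §4–§5], made unconditional-in-form relative to the two deep
inputs `PastenApproximationBound K` (Theorem 2.1, `d = 1`, linear forms in logarithms) and the
Shimura-curve bound `∏ ν_p(abc) ≤ κ rad(abc)³` (Theorem 2.5 with `ε = 1/3`), both taken as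
hypotheses. Notation: `R = rad(abc)`, `L = log R ≥ L⋆`, `B = exp √(L log L)`, `y = log c`,
`Y = log max{e, 2y}`.

* `apriori_bound`: `log c ≤ R⁴` — the exponential a-priori bound which the source imports from
  Stewart–Tijdeman [ABC1] (`h(ξ) = log c ≤ R^{K'}`); here it is re-derived from the same
  approximation bound (archimedean place if `a ≤ √c`, the place `p₀ ∣ a` of maximal exponent
  otherwise), so that no third deep input is needed. Consequently `Y ≤ 5L`.
* `thm_1_4_1_core`: if `a ≤ c^{1−η}`, `η > 0`, then `log c < η⁻¹ B^{12}` (Theorem 1.4 (1)).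
* `case_two_a`: if `log c < 2 log a` and `p₀ ∣ a` has maximal exponent, `log c < p₀ B^{13}`.
* `case_two_c`: if `p₀ ∣ c` has maximal exponent (and `ab > 1`), `log c < p₀ B^{13}`.
The assembly of Theorem 1.4 (2) with `q = min{P(a), P(b), P(c)}` is in
`Literature/Barriers/ABC/BakerMethodBoundsProofs.lean`.

## References

* [Pasten2024] H. Pasten, Invent. Math. 236 (2024), 373–385, doi:10.1007/s00222-024-01244-6,
  arXiv:2312.03566 — Theorem 1.4, §4, §5.
-/

noncomputable section

open Finset Real Height
open Literature.NumberTheory.DiophantineGeometry.Dioph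

namespace Literature.NumberTheory.DiophantineGeometry.Pasten

section triple

variable {a b c : ℕ} {K κ : ℝ}

/-- abc triples are symmetric in `a, b`. [folklore] -/
theorem _root_.Literature.NumberTheory.DiophantineGeometry.IsABCTriple.swap (h : IsABCTriple a b c) :
    IsABCTriple b a c := by
  obtain ⟨ha, hb, habc, hcop⟩ := h
  exact ⟨hb, ha, by omega, hcop.symm⟩

/-- `rad(bac) = rad(abc)`. [folklore] -/
theorem _root_.Literature.NumberTheory.DiophantineGeometry.rad_swap (a b c : ℕ) :
    rad b a c = rad a b c := by
  rw [rad_def, rad_def, mul_comm b a]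

/-- A prime dividing `abc` is at most `rad(abc)`. [folklore] -/
theorem prime_le_rad {p : ℕ} (hp : p.Prime) (hpabc : p ∣ a * b * c) (h0 : a * b * c ≠ 0) :
    p ≤ rad a b c := by
  have hmem : p ∈ (rad a b c).primeFactors := by
    rw [rad_def, Nat.primeFactors_radical, Nat.mem_primeFactors]
    exact ⟨hp, hpabc, h0⟩
  exact Nat.le_of_dvd (by rw [rad_def]; exact Nat.radical_pos _) (Nat.dvd_of_mem_primeFactors hmem)

/-- `0 < log rad(abc)` for an abc triple (`rad(abc) ≥ 2`). [folklore] -/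
theorem log_rad_pos (h : IsABCTriple a b c) : 0 < Real.log (rad a b c : ℕ) := by
  obtain ⟨ha, hb, habc, -⟩ := h
  have h2 : 2 ≤ rad a b c := by
    rw [rad_def, Nat.two_le_radical_iff]
    calc 2 ≤ c := by omega
      _ ≤ a * b * c := Nat.le_mul_of_pos_left c (Nat.mul_pos ha hb)
  exact Real.log_pos (by exact_mod_cast h2)

/-- **At a prime `p₀ ∣ a` of maximal exponent, when `log c < 2 log a`:**
`log c < 10 · L · Θ_{b,c} · p₀ · Y`. [cite: Pasten2024, §5] -/
theorem log_lt_of_lt_two_mul_log (hK : 1 ≤ K) (hP : PastenApproximationBound K)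
    (h : IsABCTriple a b c) (N : ℕ) (hya : Real.log c < 2 * Real.log a) {p₀ : ℕ}
    (hp₀ : p₀ ∈ a.primeFactors) (hmax : ∀ p ∈ a.primeFactors, a.factorization p ≤ a.factorization p₀) :
    Real.log c < 10 * Real.log (rad a b c : ℕ) * theta K b c N * p₀ *
      Real.log (max (Real.exp 1) (2 * Real.log c)) := by
  obtain ⟨ha, hb, habc, hcop⟩ := id h
  set L : ℝ := Real.log (rad a b c : ℕ) with hLdef
  set Y : ℝ := Real.log (max (Real.exp 1) (2 * Real.log c)) with hYdef
  have hc : 0 < c := by omega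
  have hL0 : 0 < L := log_rad_pos h
  have hY1 : 1 ≤ Y := one_le_log_max_exp _
  have hΘ0 : 0 ≤ theta K b c N := theta_nonneg (zero_le_one.trans hK) b c N
  have hp₀' : p₀.Prime := Nat.prime_of_mem_primeFactors hp₀
  have hp₀a : p₀ ∣ a := Nat.dvd_of_mem_primeFactors hp₀
  set ν : ℝ := (a.factorization p₀ : ℝ) with hν
  have hsize : Real.log a ≤ ν * L := by
    have h1 := log_le_factorization_mul_log_radical (p₀ := p₀) ha.ne' hmax
    have h2 : Real.log (UniqueFactorizationMonoid.radical a : ℕ) ≤ L := by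
      rw [hLdef, rad_def]
      exact log_radical_le_of_dvd (Dvd.intro (b * c) (by ring)) (by positivity)
    exact h1.trans (mul_le_mul_of_nonneg_left h2 (Nat.cast_nonneg _))
  have hpad := padic_bound_a hK hP h N hp₀' hp₀a
  have hp2 : Real.log 2 ≤ Real.log p₀ :=
    Real.log_le_log two_pos (by exact_mod_cast hp₀'.two_le)
  have hν5 : ν < 5 * theta K b c N * p₀ * Y :=
    lt_five_mul_of_mul_log_lt hp2 hY1 hΘ0 (Nat.cast_nonneg p₀) hpad
  calc Real.log c < 2 * Real.log a := hya
    _ ≤ 2 * L * ν := by nlinarith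
    _ < 2 * L * (5 * theta K b c N * p₀ * Y) := mul_lt_mul_of_pos_left hν5 (by linarith)
    _ = _ := by ring

/-- **At a prime `p₀ ∣ c` of maximal exponent:** `log c < 5 · L · Θ_{a,b} · p₀ · Y`
(needs `ab > 1`). [cite: Pasten2024, §5] -/
theorem log_lt_of_prime_dvd_c (hK : 1 ≤ K) (hP : PastenApproximationBound K)
    (h : IsABCTriple a b c) (h1 : 1 < a * b) (N : ℕ) {p₀ : ℕ} (hp₀ : p₀ ∈ c.primeFactors)
    (hmax : ∀ p ∈ c.primeFactors, c.factorization p ≤ c.factorization p₀) :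
    Real.log c < 5 * Real.log (rad a b c : ℕ) * theta K a b N * p₀ *
      Real.log (max (Real.exp 1) (2 * Real.log c)) := by
  obtain ⟨ha, hb, habc, hcop⟩ := id h
  set L : ℝ := Real.log (rad a b c : ℕ) with hLdef
  set Y : ℝ := Real.log (max (Real.exp 1) (2 * Real.log c)) with hYdef
  have hc : c ≠ 0 := by omega
  have hL0 : 0 < L := log_rad_pos h
  have hY1 : 1 ≤ Y := one_le_log_max_exp _
  have hΘ0 : 0 ≤ theta K a b N := theta_nonneg (zero_le_one.trans hK) a b N
  have hp₀' : p₀.Prime := Nat.prime_of_mem_primeFactors hp₀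
  have hp₀c : p₀ ∣ c := Nat.dvd_of_mem_primeFactors hp₀
  set ν : ℝ := (c.factorization p₀ : ℝ) with hν
  have hsize : Real.log c ≤ ν * L := by
    have h1 := log_le_factorization_mul_log_radical (p₀ := p₀) hc hmax
    have h2 : Real.log (UniqueFactorizationMonoid.radical c : ℕ) ≤ L := by
      rw [hLdef, rad_def]
      exact log_radical_le_of_dvd (Dvd.intro_left (a * b) rfl) (by positivity)
    exact h1.trans (mul_le_mul_of_nonneg_left h2 (Nat.cast_nonneg _))
  have hpad := padic_bound_c hK hP h h1 N hp₀' hp₀c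
  have hp2 : Real.log 2 ≤ Real.log p₀ :=
    Real.log_le_log two_pos (by exact_mod_cast hp₀'.two_le)
  have hν5 : ν < 5 * theta K a b N * p₀ * Y :=
    lt_five_mul_of_mul_log_lt hp2 hY1 hΘ0 (Nat.cast_nonneg p₀) hpad
  calc Real.log c ≤ ν * L := hsize
    _ = L * ν := by ring
    _ < L * (5 * theta K a b N * p₀ * Y) := mul_lt_mul_of_pos_left hν5 hL0
    _ = _ := by ring

/-- **A-priori bound** (in place of Stewart–Tijdeman's `log c ≤ κ R^{15}` used in the source):
for an abc triple with `log R ≥ L⋆` and `∏ ν_p(abc) ≤ κ R³`, `log c ≤ R⁴`.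
[cite: Pasten2024, §4] -/
theorem apriori_bound (hK : 1 ≤ K) (hκ : 1 ≤ κ) (hP : PastenApproximationBound K)
    (h : IsABCTriple a b c) (hL : Lstar K κ ≤ Real.log (rad a b c : ℕ))
    (hE : (exponentProduct (a * b * c) : ℝ) ≤ κ * (rad a b c : ℝ) ^ 3) :
    Real.log c ≤ (rad a b c : ℝ) ^ 4 := by
  obtain ⟨ha, hb, habc, hcop⟩ := id h
  set R : ℝ := ((rad a b c : ℕ) : ℝ) with hR
  set L : ℝ := Real.log R with hLdef
  set s : ℝ := Real.sqrt (L * Real.log L) with hs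
  set N : ℕ := ⌊bfun R⌋₊ with hN
  set y : ℝ := Real.log c with hy
  set Y : ℝ := Real.log (max (Real.exp 1) (2 * y)) with hYdef
  have hc : 0 < c := by omega
  have hR0 : 0 < R := by
    rw [hR, rad_def]; exact_mod_cast Nat.radical_pos _
  have hRexp : R = Real.exp L := (Real.exp_log hR0).symm
  have hL1 : 1 ≤ L := one_le_of_Lstar_le hL
  have hY1 : 1 ≤ Y := one_le_log_max_exp _
  have hy0 : 0 ≤ y := Real.log_nonneg (by exact_mod_cast hc)
  have hK0 : 0 ≤ K := zero_le_one.trans hK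
  have hΘ : theta K b c N ≤ K * Real.exp s ^ 10 := theta_bc_le hK hκ h hL hE
  have hΘ0 : 0 ≤ theta K b c N := theta_nonneg hK0 b c N
  have hR1 : 1 ≤ R := by
    rw [hRexp]; have := Real.add_one_le_exp L; linarith
  set M : ℝ := 10 * K * L * Real.exp s ^ 10 * R with hM
  -- Step 1: `y ≤ M · Y` in both cases.
  have hclaim : y ≤ M * Y := by
    by_cases hcase : 2 * Real.log a ≤ y
    · have harch := arch_bound hK hP h N
      have h2 : 2 * theta K b c N ≤ M := by
        have hKB : 0 ≤ K * Real.exp s ^ 10 := by positivity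
        calc 2 * theta K b c N ≤ 2 * (K * Real.exp s ^ 10) := by linarith
          _ = 2 * (K * Real.exp s ^ 10) * 1 * 1 := by ring
          _ ≤ (10 * L) * (K * Real.exp s ^ 10) * 1 * R := by
              apply mul_le_mul _ hR1 zero_le_one (by positivity)
              exact mul_le_mul_of_nonneg_right
                (mul_le_mul_of_nonneg_right (by linarith) hKB) zero_le_one
          _ = M := by rw [hM]; ring
      calc y ≤ 2 * (y - Real.log a) := by linarith
        _ ≤ 2 * (theta K b c N * Y) := by linarith
        _ = (2 * theta K b c N) * Y := by ring
        _ ≤ M * Y := mul_le_mul_of_nonneg_right h2 (by linarith)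
    · push Not at hcase
      have ha2 : 1 < a := by
        by_contra hle
        push Not at hle
        have ha1 : a = 1 := le_antisymm hle ha
        rw [ha1, Nat.cast_one, Real.log_one, mul_zero] at hcase
        linarith
      obtain ⟨p₀, hp₀, hmax⟩ := Finset.exists_max_image a.primeFactors
        (fun p => a.factorization p) (Nat.nonempty_primeFactors.mpr ha2)
      have hp₀' : p₀.Prime := Nat.prime_of_mem_primeFactors hp₀
      have hkey := log_lt_of_lt_two_mul_log hK hP h N hcase hp₀ hmax
      have hp₀R : (p₀ : ℝ) ≤ R := by
        rw [hR]
        exact_mod_cast prime_le_rad hp₀' ((Nat.dvd_of_mem_primeFactors hp₀).trans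
          (Dvd.intro (b * c) (by ring))) (by positivity)
      calc y ≤ 10 * L * theta K b c N * p₀ * Y := hkey.le
        _ ≤ 10 * L * (K * Real.exp s ^ 10) * R * Y := by
            apply mul_le_mul_of_nonneg_right _ (by linarith)
            exact mul_le_mul (mul_le_mul_of_nonneg_left hΘ (by linarith)) hp₀R
              (Nat.cast_nonneg _) (by positivity)
        _ = M * Y := by rw [hM]; ring
  -- Step 2: self-improvement on `z = 2y`.
  have hM0 : 0 ≤ M := by positivity
  have hz : 2 * y ≤ 2 * M * Real.log (max (Real.exp 1) (2 * y)) := by rw [← hYdef]; linarith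
  have hz' := le_max_of_le_mul_log_max (by positivity) hz
  have h40 : 40 * K * L * Real.exp s ^ 10 ≤ R := by
    rw [hRexp]
    exact const_mul_mul_mul_pow_le_exp hK hL (by norm_num) (by norm_num)
  have h16 : 4 * (2 * M) ^ 2 ≤ R ^ 4 := by
    have h4 : 4 * M ≤ R * R := by
      calc 4 * M = 40 * K * L * Real.exp s ^ 10 * R := by rw [hM]; ring
        _ ≤ R * R := mul_le_mul_of_nonneg_right h40 hR0.le
    calc 4 * (2 * M) ^ 2 = (4 * M) ^ 2 := by ring
      _ ≤ (R * R) ^ 2 := pow_le_pow_left₀ (by positivity) h4 2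
      _ = R ^ 4 := by ring
  have hRe : Real.exp 1 ≤ R ^ 4 := by
    have hR1' : Real.exp 1 ≤ R := by rw [hRexp]; exact Real.exp_le_exp.mpr hL1
    calc Real.exp 1 ≤ R := hR1'
      _ = R ^ 1 := (pow_one R).symm
      _ ≤ R ^ 4 := pow_le_pow_right₀ hR1 (by norm_num)
  calc y ≤ 2 * y := by linarith
    _ ≤ max (Real.exp 1) (4 * (2 * M) ^ 2) := hz'
    _ ≤ R ^ 4 := max_le hRe h16

/-- `Y = log max{e, 2 log c} ≤ 5 L` (from the a-priori bound). [cite: Pasten2024, §4] -/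
theorem log_max_two_mul_log_le (hK : 1 ≤ K) (hκ : 1 ≤ κ) (hP : PastenApproximationBound K)
    (h : IsABCTriple a b c) (hL : Lstar K κ ≤ Real.log (rad a b c : ℕ))
    (hE : (exponentProduct (a * b * c) : ℝ) ≤ κ * (rad a b c : ℝ) ^ 3) :
    Real.log (max (Real.exp 1) (2 * Real.log c)) ≤ 5 * Real.log (rad a b c : ℕ) := by
  have hAP := apriori_bound hK hκ hP h hL hE
  set R : ℝ := ((rad a b c : ℕ) : ℝ) with hR
  set L : ℝ := Real.log R with hLdef
  have hR0 : 0 < R := by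
    rw [hR, rad_def]; exact_mod_cast Nat.radical_pos _
  have hRexp : R = Real.exp L := (Real.exp_log hR0).symm
  have hL1 : 1 ≤ L := one_le_of_Lstar_le hL
  have hR1 : Real.exp 1 ≤ R := by rw [hRexp]; exact Real.exp_le_exp.mpr hL1
  have hR1' : 1 ≤ R := le_trans (by have := Real.add_one_le_exp (1 : ℝ); linarith) hR1
  have hRe : Real.exp 1 ≤ 2 * R ^ 4 := by
    calc Real.exp 1 ≤ R := hR1
      _ = R ^ 1 := (pow_one R).symm
      _ ≤ R ^ 4 := pow_le_pow_right₀ hR1' (by norm_num)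
      _ ≤ 2 * R ^ 4 := by linarith [pow_nonneg hR0.le 4]
  have hlog2 : Real.log 2 ≤ 1 := by
    have := Real.log_two_lt_d9; linarith
  calc Real.log (max (Real.exp 1) (2 * Real.log c)) ≤ Real.log (2 * R ^ 4) :=
        log_max_exp_le hRe (by linarith)
    _ = Real.log 2 + 4 * L := by
        rw [Real.log_mul two_ne_zero (pow_pos hR0 4).ne', Real.log_pow]; push_cast; ring
    _ ≤ 5 * L := by linarith

/-- **Theorem 1.4 (1), core form.** For an abc triple with `log R ≥ L⋆`, `∏ ν_p(abc) ≤ κ R³`,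
and `a ≤ c^{1−η}` with `η > 0`: `log c < η⁻¹ · B^{12}`, `B = exp √((log R) log₂ R)`.
[cite: Pasten2024, Theorem 1.4 (1)] -/
theorem thm_1_4_1_core (hK : 1 ≤ K) (hκ : 1 ≤ κ) (hP : PastenApproximationBound K)
    (h : IsABCTriple a b c) (hL : Lstar K κ ≤ Real.log (rad a b c : ℕ))
    (hE : (exponentProduct (a * b * c) : ℝ) ≤ κ * (rad a b c : ℝ) ^ 3)
    {η : ℝ} (hη : 0 < η) (hac : (a : ℝ) ≤ (c : ℝ) ^ (1 - η)) :
    Real.log c < η⁻¹ * bfun (rad a b c : ℕ) ^ 12 := by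
  obtain ⟨ha, hb, habc, hcop⟩ := id h
  set R : ℝ := ((rad a b c : ℕ) : ℝ) with hR
  set L : ℝ := Real.log R with hLdef
  set s : ℝ := Real.sqrt (L * Real.log L) with hs
  set N : ℕ := ⌊bfun R⌋₊ with hN
  set y : ℝ := Real.log c with hy
  set Y : ℝ := Real.log (max (Real.exp 1) (2 * y)) with hYdef
  have hc : 0 < c := by omega
  have ha' : (0 : ℝ) < a := by exact_mod_cast ha
  have hc' : (0 : ℝ) < c := by exact_mod_cast hc
  have hL1 : 1 ≤ L := one_le_of_Lstar_le hL
  have hY1 : 1 ≤ Y := one_le_log_max_exp _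
  have hK0 : 0 ≤ K := zero_le_one.trans hK
  have hloga : Real.log a ≤ (1 - η) * y := by
    have := Real.log_le_log ha' hac
    rwa [Real.log_rpow hc'] at this
  have harch := arch_bound hK hP h N
  have hY5 : Y ≤ 5 * L := log_max_two_mul_log_le hK hκ hP h hL hE
  have hΘ : theta K b c N ≤ K * Real.exp s ^ 10 := theta_bc_le hK hκ h hL hE
  have h5 : 5 * K * L ≤ Real.exp s ^ 2 := const_mul_mul_le_exp_sq hK hL (by norm_num)
  have hmain : η * y < Real.exp s ^ 12 := by
    calc η * y ≤ y - Real.log a := by linarith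
      _ < theta K b c N * Y := harch
      _ ≤ K * Real.exp s ^ 10 * (5 * L) := mul_le_mul hΘ hY5 (by linarith) (by positivity)
      _ = 5 * K * L * Real.exp s ^ 10 := by ring
      _ ≤ Real.exp s ^ 2 * Real.exp s ^ 10 := mul_le_mul_of_nonneg_right h5 (by positivity)
      _ = Real.exp s ^ 12 := by ring
  calc y = η⁻¹ * (η * y) := by field_simp
    _ < η⁻¹ * Real.exp s ^ 12 := mul_lt_mul_of_pos_left hmain (inv_pos.mpr hη)

/-- **Case `x = a` of Theorem 1.4 (2).** If `log c < 2 log a` and `p₀ ∣ a` has maximal exponent,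
then `log c < p₀ · B^{13}`. [cite: Pasten2024, §5] -/
theorem case_two_a (hK : 1 ≤ K) (hκ : 1 ≤ κ) (hP : PastenApproximationBound K)
    (h : IsABCTriple a b c) (hL : Lstar K κ ≤ Real.log (rad a b c : ℕ))
    (hE : (exponentProduct (a * b * c) : ℝ) ≤ κ * (rad a b c : ℝ) ^ 3)
    (hya : Real.log c < 2 * Real.log a) {p₀ : ℕ} (hp₀ : p₀ ∈ a.primeFactors)
    (hmax : ∀ p ∈ a.primeFactors, a.factorization p ≤ a.factorization p₀) :
    Real.log c < p₀ * bfun (rad a b c : ℕ) ^ 13 := by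
  set R : ℝ := ((rad a b c : ℕ) : ℝ) with hR
  set L : ℝ := Real.log R with hLdef
  set s : ℝ := Real.sqrt (L * Real.log L) with hs
  set N : ℕ := ⌊bfun R⌋₊ with hN
  set Y : ℝ := Real.log (max (Real.exp 1) (2 * Real.log c)) with hYdef
  have hL1 : 1 ≤ L := one_le_of_Lstar_le hL
  have hY1 : 1 ≤ Y := one_le_log_max_exp _
  have hK0 : 0 ≤ K := zero_le_one.trans hK
  have hkey := log_lt_of_lt_two_mul_log hK hP h N hya hp₀ hmax
  have hY5 : Y ≤ 5 * L := log_max_two_mul_log_le hK hκ hP h hL hE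
  have hΘ : theta K b c N ≤ K * Real.exp s ^ 10 := theta_bc_le hK hκ h hL hE
  have hΘ0 : 0 ≤ theta K b c N := theta_nonneg hK0 b c N
  have h50 : 50 * K * L ^ 2 ≤ Real.exp s ^ 3 := const_mul_mul_sq_le_exp_cube hK hL (by norm_num)
  have hp0 : (0 : ℝ) ≤ p₀ := Nat.cast_nonneg _
  calc Real.log c < 10 * L * theta K b c N * p₀ * Y := hkey
    _ ≤ 10 * L * (K * Real.exp s ^ 10) * p₀ * (5 * L) := by
        apply mul_le_mul _ hY5 (by linarith) (by positivity)
        exact mul_le_mul_of_nonneg_right (mul_le_mul_of_nonneg_left hΘ (by linarith)) hp0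
    _ = 50 * K * L ^ 2 * Real.exp s ^ 10 * p₀ := by ring
    _ ≤ Real.exp s ^ 3 * Real.exp s ^ 10 * p₀ := by
        apply mul_le_mul_of_nonneg_right _ hp0
        exact mul_le_mul_of_nonneg_right h50 (by positivity)
    _ = p₀ * Real.exp s ^ 13 := by ring

/-- **Case `x = c` of Theorem 1.4 (2).** If `p₀ ∣ c` has maximal exponent (and `ab > 1`), then
`log c < p₀ · B^{13}`. [cite: Pasten2024, §5] -/
theorem case_two_c (hK : 1 ≤ K) (hκ : 1 ≤ κ) (hP : PastenApproximationBound K)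
    (h : IsABCTriple a b c) (hL : Lstar K κ ≤ Real.log (rad a b c : ℕ))
    (hE : (exponentProduct (a * b * c) : ℝ) ≤ κ * (rad a b c : ℝ) ^ 3)
    (h1 : 1 < a * b) {p₀ : ℕ} (hp₀ : p₀ ∈ c.primeFactors)
    (hmax : ∀ p ∈ c.primeFactors, c.factorization p ≤ c.factorization p₀) :
    Real.log c < p₀ * bfun (rad a b c : ℕ) ^ 13 := by
  set R : ℝ := ((rad a b c : ℕ) : ℝ) with hR
  set L : ℝ := Real.log R with hLdef
  set s : ℝ := Real.sqrt (L * Real.log L) with hs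
  set N : ℕ := ⌊bfun R⌋₊ with hN
  set Y : ℝ := Real.log (max (Real.exp 1) (2 * Real.log c)) with hYdef
  have hL1 : 1 ≤ L := one_le_of_Lstar_le hL
  have hY1 : 1 ≤ Y := one_le_log_max_exp _
  have hK0 : 0 ≤ K := zero_le_one.trans hK
  have hkey := log_lt_of_prime_dvd_c hK hP h h1 N hp₀ hmax
  have hY5 : Y ≤ 5 * L := log_max_two_mul_log_le hK hκ hP h hL hE
  have hΘ : theta K a b N ≤ K * Real.exp s ^ 10 := theta_ab_le hK hκ h hL hE
  have hΘ0 : 0 ≤ theta K a b N := theta_nonneg hK0 a b N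
  have h25 : 25 * K * L ^ 2 ≤ Real.exp s ^ 3 := const_mul_mul_sq_le_exp_cube hK hL (by norm_num)
  have hp0 : (0 : ℝ) ≤ p₀ := Nat.cast_nonneg _
  calc Real.log c < 5 * L * theta K a b N * p₀ * Y := hkey
    _ ≤ 5 * L * (K * Real.exp s ^ 10) * p₀ * (5 * L) := by
        apply mul_le_mul _ hY5 (by linarith) (by positivity)
        exact mul_le_mul_of_nonneg_right (mul_le_mul_of_nonneg_left hΘ (by linarith)) hp0
    _ = 25 * K * L ^ 2 * Real.exp s ^ 10 * p₀ := by ring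
    _ ≤ Real.exp s ^ 3 * Real.exp s ^ 10 * p₀ := by
        apply mul_le_mul_of_nonneg_right _ hp0
        exact mul_le_mul_of_nonneg_right h25 (by positivity)
    _ = p₀ * Real.exp s ^ 13 := by ring

end triple

end Literature.NumberTheory.DiophantineGeometry.Pasten

end
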